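import Summits.HodgeConjecture.HodgeConjecture.Theorems.F0P2oXThetaOwnClass
import Literature.RepresentationTheory.MoeglinVignerasWaldspurger1987.RankOneThetaLiftSeparationHolds
import Literature.RepresentationTheory.MoeglinVignerasWaldspurger1987.RankOneThetaLiftLinesEquivalent
import Literature.NumberTheory.Automorphic.Liu2021.LemD1Item3AtVOfSeparation
import Literature.NumberTheory.Automorphic.Liu2021.LemD1AsPrintedIndexedNonVacuityNonsplitPlace
import Literature.NumberTheory.GelbartRogawski1991.LocalLineModelTransport
import HarnessLib

/-!
# Crux `H413`, programme P2, road (T) «UP THE TOWER» step (5) — RANK-3 ε-RIGIDITY of Liu's local theta type in `xThetaCM` currency: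
# `X_v(μ, ε₁, χ_f) ≅ X_v(μ, ε₂, χ_f)` at a non-split place forces `ε₂ ∕ ε₁ ∈ N(L_wˣ)`

Cell hodgecm-mathlib (D-0151), FLOOR 0, crux item H413 = stmt-HodgeConjecture-24833, programme P2; booked row «U1-DISJOINT» (desk F0P2-plan (g7)
15:40:57Z), road (T) «UP THE TOWER» (F0P2-p01 (g7) 15:44:49Z, desk 15:45:07Z, ref1 r156), hands B-p18 (g28) 15:55:29Z: step (5) → F0P2-p05 (g0)
(THIS FILE), steps (1)+(4) → p01 (g7), step (6) → A-p12 (g16).  THEOREMS ONLY (no `def`, no instance, no notation, no named fact, no `sorry`);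
kernel lane `--supports stmt-HodgeConjecture-24833 --as helper`.  HC_CM is proved only modulo the 2 remaining named inputs (hLiu418, h413)
until rung 0 closes; this file discharges none of them and asserts nothing printed: its one external input is the tree THEOREM
★ `rankOne_theta_epsClass_and_char_eq_of_areIsomorphicRep_unconditional` (B-p13's separation package over the PROVED IV-4c1
`rankOne_theta_lines_disjoint_holds`, [MoeglinVignerasWaldspurger1987, Chap. 3 IV.4]).

WHAT.  For a CM field `L`, a real non-zero diagonal frame `dV` of rank 3 (reindexing `Equiv.prodUnique (Fin 3) (Fin 1)`, the frame road (T)'s step (1)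
chooses), `μ` conjugate-symplectic, a CONTINUOUS UNITARY character `χ_f` of `U(1)(𝔸_{L⁺,f})` (NOT assumed automorphic — road (T) globalises a local
`ψ` as `(ψ·μ_v) ∘ pr_v`, which is not), a NON-SPLIT finite place `v` and two lines `ε₁, ε₂ ∈ (L⁺)ˣ`:
* §1 `areIsomorphicRep_xThetaCM_theta` — MODEL TRANSPORT: Liu's local theta type `X_v(μ, ε, χ_f)` (★ `xThetaCM`, a representation of
  `U(diag dV)(L⁺_v)`) is «isomorphic» (★ `AreIsomorphicRep`) to the rank-one theta lift `Θ_{s_ε}(χ_{f,v})` of [MVW87 Chap. 3 IV] in the currency of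
  ★ `RankOneThetaLift.lean` — the `χ_{f,v}`-coinvariants of `ω_{s_ε} = (toRep (localSchrodinger L⁺ 3 (realDiagonal dV) v)).comp s_ε` for the
  `e′_ε`-TRANSPORTED section `s_ε := lineTransportSection … ε v ((𝓢_ε).s v) …` (★ `LocalLineModelTransport`, over `ι_{ε⁻¹·δ}`, `δ = imagUnit L`) on the
  COMMON model, the centre `E¹_v` presented at ANY line `J₁`.  Chain (the template of ★ `LemD1Item3AtVOfSeparation` §2, WITHOUT its `Chi`-indexed
  wrapper): same relation submodule along `k ↦ k ⊗ 1` (★ `omegaLoc_comp_localLineInl_comp_localCenter`) · identity of `𝒮(L⁺_v³)` intertwines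
  (★ `omega_lineTransportSection_finLocalSplittings`, ★ `TwistedCoinv.exists_equivariant_of_equivariant`) · change of the line presenting the
  centre (★ `LemD1OfPlace.ker_localCenter_eq_of_line`);
* §2 HEAD `exists_mul_conj_eq_ratio_of_areIsomorphicRep_xThetaCM` — if `X_v(μ, ε₁, χ_f) ≅ X_v(μ, ε₂, χ_f)` then
  `∃ x ∈ L_wˣ, x·x̄ = ε₂ε₁⁻¹` (the NEGATION of the non-norm clause of A-p12 (g16)'s ‹U1-DISJOINT› binder 16:03:25Z, token for token): §1 twice at
  `J₁ := (ε₁)`, non-vanishing of `Θ_{s_{ε₁}}` by the PROVED [MVW87 IV.2] ★ `mvw_IV2_rankOne_nonvanishing_of_isotropic_holds` (rank 3 isotropic, ★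
  `isIsotropic_standingData_of_three_le`), then ★ `rankOne_theta_epsClass_and_char_eq_of_areIsomorphicRep_unconditional` and the class read-out ★
  `sameClass_epsLine_iff_sameClass_eps_lineDelta` ∕ ★ `coe_epsLine`; front-ends from a `Representation.Equiv` and from the classes∕representations on
  `Gqs L v = U(Φ₃)(L⁺_v)` through ONE common congruence (road (T) step (4) ends there).

## References
* [MoeglinVignerasWaldspurger1987] C. Mœglin, M.-F. Vignéras, J.-L. Waldspurger, LNM 1291 (1987), Chap. 2 II.1; Chap. 3 IV.2, IV.4 Thm principal.
* [Liu2021] Y. Liu, Camb. J. Math. 9 (2021) = arXiv:2102.11518: Def. 4.11 (l. 2090–2096); App. D §D.1 Steps 1–3, Lem. D.1 (3) (l. 5233).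
* [GelbartRogawski1991] Invent. Math. 105 (1991), §3.1 Prop. 3.1.1; Remark p. 466.  [HarrisKudlaSweet1996] JAMS 9 (1996), Cor. 4.4 (m = n = 1).
* [PlatonovRapinchuk1994] §2.3.  [BushnellHenniart2006] §1.1.
-/

set_option autoImplicit false
set_option linter.dupNamespace false -- the mandated namespace repeats the single-problem summit's segment

noncomputable section

open NumberField IsDedekindDomain MeasureTheory
open scoped Matrix Kronecker

namespace Summit.HodgeConjecture.HodgeConjecture.Cruxes.H413.F0P2oXThetaLineRigidity

open Literature.NumberTheory Literature.NumberTheory.Automorphic Literature.NumberTheory.Automorphic.UnitaryGroup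
open Literature.NumberTheory.Automorphic.IdeleClassGroup
open Literature.NumberTheory.Automorphic.Liu2021 Literature.NumberTheory.Automorphic.Liu2021.Def411WeilCarriers
open Literature.NumberTheory.Automorphic.Liu2021.Def411WeilCarriersDoubling
open Literature.NumberTheory.GelbartRogawski1991 Literature.NumberTheory.GelbartRogawski1991.UnitaryDualPair
open Literature.NumberTheory.GelbartRogawski1991.UnitaryDualPair.WeilCoinv
open Literature.NumberTheory.GelbartRogawski1991.GRConstruction
open Literature.NumberTheory.GelbartRogawski1991.UnitaryDualPair.LocalSplitting
open Literature.RepresentationTheory Literature.RepresentationTheory.Liu2021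
open Literature.RepresentationTheory.HeisenbergGroup (MpPsi)
open Literature.RepresentationTheory.MoeglinVignerasWaldspurger1987
open Literature.NumberTheory.GaloisRepresentations Literature.NumberTheory.Rogawski1990

variable (L : Type) [Field L] [NumberField L] [IsCMField L] (dV : Fin 3 → L)
    (hdV : ∀ i, IsCMField.complexConj L (dV i) = dV i) (hdV0 : ∀ i, dV i ≠ 0)
    (μ : Literature.NumberTheory.Automorphic.IdeleClassGroup L →ₜ* Circle) (hμ : IsConjugateSymplectic L μ)
    (χf : UnitaryGroup.finAdelicOne (↥(maximalRealSubfield L)) L (IsCMField.complexConj L) →* ℂˣ)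
    (hcont : Continuous χf) (hunit : ∀ z, ‖((χf z : ℂˣ) : ℂ)‖ = 1)
    (v : HeightOneSpectrum (𝓞 ↥(maximalRealSubfield L)))

/-! ## §1 Model transport: `X_v(μ, ε, χ_f) ≅ Θ_{s_ε}(χ_{f,v})` on the common model, the centre presented at any line `J₁` -/

set_option synthInstance.maxHeartbeats 400000 in
set_option maxHeartbeats 16000000 in
/-- **MODEL TRANSPORT.**  Liu's local theta type `X_v(μ, ε, χ_f)` (★ `xThetaCM` at the reindexing `Equiv.prodUnique (Fin 3) (Fin 1)`) is
«isomorphic» (★ `AreIsomorphicRep`) to the rank-one theta lift of ★ `RankOneThetaLift.lean`'s currency: the `χ_{f,v}`-coinvariants (centre presented at the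
line `J₁`, ★ `localCharOfCenter … J₁ … χf v`) of `ω_{s_ε}`, `s_ε` the `e′_ε`-transport (★ `lineTransportSection`) of the CM section `(𝓢_ε).s v`
(`𝓢_ε = chiLocalSplittingsCM … μ … ε`) to the COMMON model `LocalMp L⁺ 3 (realDiagonal dV) v` (over `ι_{ε⁻¹·imagUnit}`).  Every finite `v`, every line `J₁`.
[cite: MoeglinVignerasWaldspurger1987, Chap. 2 II.1; Chap. 3 IV] [cite: Liu2021, App. D §D.1 Step 3 (l. 5221)] [cite: GelbartRogawski1991, §3.1 Prop. 3.1.1 p. 455] -/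
theorem areIsomorphicRep_xThetaCM_theta (ε : (↥(maximalRealSubfield L))ˣ) (J₁ : Matrix (Fin 1) (Fin 1) L) (hJ₁ : J₁ 0 0 ≠ 0) :
    AreIsomorphicRep (xThetaCM L (Equiv.prodUnique (Fin 3) (Fin 1)) dV hdV hdV0 μ hμ χf ε v)
      (TwistedCoinv.rep
        (ρW := show Representation ℂ (localPi L (IsCMField.complexConj L) 1 J₁ v) (SchwartzBruhat (Fin 3 → v.adicCompletion (↥(maximalRealSubfield L)))) from
          ((MpPsi.toRep (localSchrodinger (↥(maximalRealSubfield L)) 3 (realDiagonal L dV hdV) v)).comp (lineTransportSection (↥(maximalRealSubfield L)) L (IsCMField.complexConj L) 3 (complexConj_imagUnit L) (imagUnit_ne_zero L) (imagUnit_mul_self L) (realDiagonal L dV hdV) (realDiagonal_isSymm L dV hdV) (Matrix.diagonal dV) (realDiagonal_map L dV hdV).symm ε v ((chiLocalSplittingsCM L (Equiv.prodUnique (Fin 3) (Fin 1)) dV hdV hdV0 (toHeckeCharacter L μ) ((isOscillatorChar_toHeckeCharacter_iff μ).mpr hμ) ε).s v) ((chiLocalSplittingsCM L (Equiv.prodUnique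 (Fin 3) (Fin 1)) dV hdV hdV0 (toHeckeCharacter L μ) ((isOscillatorChar_toHeckeCharacter_iff μ).mpr hμ) ε).proj_s v))).comp (localCenter L (IsCMField.complexConj L) 3 (Matrix.diagonal dV) J₁ hJ₁ v))
        (localCharOfCenter (↥(maximalRealSubfield L)) L (IsCMField.complexConj L) J₁ hJ₁ χf v) ((MpPsi.toRep (localSchrodinger (↥(maximalRealSubfield L)) 3 (realDiagonal L dV hdV) v)).comp (lineTransportSection (↥(maximalRealSubfield L)) L (IsCMField.complexConj L) 3 (complexConj_imagUnit L) (imagUnit_ne_zero L) (imagUnit_mul_self L) (realDiagonal L dV hdV) (realDiagonal_isSymm L dV hdV) (Matrix.diagonal dV) (realDiagonal_map L dV hdV).symm ε v ((chiLocalSplittingsCM L (Equiv.prodUnique (Fin 3) (Fin 1)) dV hdV hdV0 (toHeckeCharacter L μ) ((isOscillatorChar_toHeckeCharacter_iff μ).mpr hμ) ε).s v) ((chiLocalSplittingsCM L (Equiv.prodUnique (Fin 3) (Fin 1)) dV hdV hdV0 (toHeckeCharacter L μ) ((isOscillatorChar_toHeckeCharacter_iff μ).mpr hμ) ε).proj_s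 v)))
        (fun g z => (show Commute g ((localCenter L (IsCMField.complexConj L) 3 (Matrix.diagonal dV) J₁ hJ₁ v) z) from
          localCenter_comm L (IsCMField.complexConj L) 3 (Matrix.diagonal dV) J₁ hJ₁ v z g).map ((MpPsi.toRep (localSchrodinger (↥(maximalRealSubfield L)) 3 (realDiagonal L dV hdV) v)).comp (lineTransportSection (↥(maximalRealSubfield L)) L (IsCMField.complexConj L) 3 (complexConj_imagUnit L) (imagUnit_ne_zero L) (imagUnit_mul_self L) (realDiagonal L dV hdV) (realDiagonal_isSymm L dV hdV) (Matrix.diagonal dV) (realDiagonal_map L dV hdV).symm ε v ((chiLocalSplittingsCM L (Equiv.prodUnique (Fin 3) (Fin 1)) dV hdV hdV0 (toHeckeCharacter L μ) ((isOscillatorChar_toHeckeCharacter_iff μ).mpr hμ) ε).s v) ((chiLocalSplittingsCM L (Equiv.prodUnique (Fin 3) (Fin 1)) dV hdV hdV0 (toHeckeCharacter L μ) ((isOscillatorChar_toHeckeCharacter_iff μ).mpr hμ) ε).proj_s v))))) := by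
  have hJh : ((Matrix.diagonal dV).map (IsCMField.complexConj L))ᵀ = Matrix.diagonal dV :=
    transpose_map_conj_JV (↥(maximalRealSubfield L)) L (IsCMField.complexConj L) 3 (Matrix.diagonal dV) (realDiagonal_isSymm L dV hdV) (realDiagonal_map L dV hdV).symm
  have hJdet : (Matrix.diagonal dV).det ≠ 0 := det_JV_ne_zero (↥(maximalRealSubfield L)) L 3 (Matrix.diagonal dV) (isUnit_det_realDiagonal L dV hdV hdV0) (realDiagonal_map L dV hdV).symm
  -- (2) `X_v ≅` the coinvariants of `ω_v ∘ (k ↦ k ⊗ 1)` under the centre of `U(diag dV)` at the line `(ε)` (same relation submodule)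
  have h2 : AreIsomorphicRep (xThetaCM L (Equiv.prodUnique (Fin 3) (Fin 1)) dV hdV hdV0 μ hμ χf ε v)
      (TwistedCoinv.rep
        (ρW := show Representation ℂ (localPi L (IsCMField.complexConj L) 1 (JW (↥(maximalRealSubfield L)) L ε) v) (SchwartzBruhat (Fin 3 → v.adicCompletion (↥(maximalRealSubfield L)))) from
          (show Representation ℂ (localPi L (IsCMField.complexConj L) 3 (Matrix.diagonal dV) v) (SchwartzBruhat (Fin 3 → v.adicCompletion (↥(maximalRealSubfield L)))) from
            ((chiLocalSplittingsCM L (Equiv.prodUnique (Fin 3) (Fin 1)) dV hdV hdV0 (toHeckeCharacter L μ) ((isOscillatorChar_toHeckeCharacter_iff μ).mpr hμ) ε).omegaLoc v).comp (localLineInl L (IsCMField.complexConj L) 3 (Equiv.prodUnique (Fin 3) (Fin 1)) (Matrix.diagonal dV) (JW (↥(maximalRealSubfield L)) L ε) v)).comp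
            (localCenter L (IsCMField.complexConj L) 3 (Matrix.diagonal dV) (JW (↥(maximalRealSubfield L)) L ε) (JW_apply_ne_zero (↥(maximalRealSubfield L)) L ε) v))
        (localCharOfCenter (↥(maximalRealSubfield L)) L (IsCMField.complexConj L) (JW (↥(maximalRealSubfield L)) L ε) (JW_apply_ne_zero (↥(maximalRealSubfield L)) L ε) χf v)
        (show Representation ℂ (localPi L (IsCMField.complexConj L) 3 (Matrix.diagonal dV) v) (SchwartzBruhat (Fin 3 → v.adicCompletion (↥(maximalRealSubfield L)))) from
          ((chiLocalSplittingsCM L (Equiv.prodUnique (Fin 3) (Fin 1)) dV hdV hdV0 (toHeckeCharacter L μ) ((isOscillatorChar_toHeckeCharacter_iff μ).mpr hμ) ε).omegaLoc v).comp (localLineInl L (IsCMField.complexConj L) 3 (Equiv.prodUnique (Fin 3) (Fin 1)) (Matrix.diagonal dV) (JW (↥(maximalRealSubfield L)) L ε) v))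
        (fun g z => (show Commute g ((localCenter L (IsCMField.complexConj L) 3 (Matrix.diagonal dV) (JW (↥(maximalRealSubfield L)) L ε) (JW_apply_ne_zero (↥(maximalRealSubfield L)) L ε) v) z) from
          localCenter_comm L (IsCMField.complexConj L) 3 (Matrix.diagonal dV) (JW (↥(maximalRealSubfield L)) L ε) (JW_apply_ne_zero (↥(maximalRealSubfield L)) L ε) v z g).map
            (show Representation ℂ (localPi L (IsCMField.complexConj L) 3 (Matrix.diagonal dV) v) (SchwartzBruhat (Fin 3 → v.adicCompletion (↥(maximalRealSubfield L)))) from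
              ((chiLocalSplittingsCM L (Equiv.prodUnique (Fin 3) (Fin 1)) dV hdV hdV0 (toHeckeCharacter L μ) ((isOscillatorChar_toHeckeCharacter_iff μ).mpr hμ) ε).omegaLoc v).comp (localLineInl L (IsCMField.complexConj L) 3 (Equiv.prodUnique (Fin 3) (Fin 1)) (Matrix.diagonal dV) (JW (↥(maximalRealSubfield L)) L ε) v)))) :=
    areIsomorphicRep_coinv_of_ker_eq
      (congrArg (fun ρ => TwistedCoinv.ker ρ (localCharOfCenter (↥(maximalRealSubfield L)) L (IsCMField.complexConj L) (JW (↥(maximalRealSubfield L)) L ε) (JW_apply_ne_zero (↥(maximalRealSubfield L)) L ε) χf v))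
        (omegaLoc_comp_localLineInl_comp_localCenter (↥(maximalRealSubfield L)) L (IsCMField.complexConj L) 3 (Equiv.prodUnique (Fin 3) (Fin 1)) (Matrix.diagonal dV) (complexConj_imagUnit L) (imagUnit_ne_zero L) (imagUnit_mul_self L) (realDiagonal_isSymm L dV hdV) (realDiagonal_map L dV hdV).symm ε (chiLocalSplittingsCM L (Equiv.prodUnique (Fin 3) (Fin 1)) dV hdV hdV0 (toHeckeCharacter L μ) ((isOscillatorChar_toHeckeCharacter_iff μ).mpr hμ) ε) v)).symm _ _
      (fun g => (chiLocalSplittingsCM L (Equiv.prodUnique (Fin 3) (Fin 1)) dV hdV hdV0 (toHeckeCharacter L μ) ((isOscillatorChar_toHeckeCharacter_iff μ).mpr hμ) ε).omegaLoc v (localLineInl L (IsCMField.complexConj L) 3 (Equiv.prodUnique (Fin 3) (Fin 1)) (Matrix.diagonal dV) (JW (↥(maximalRealSubfield L)) L ε) v g)) (fun _ _ => rfl) (fun _ _ => rfl)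
  -- (3) the identity of `𝒮(L⁺_v³)` intertwines `ω_{s_ε}` with `ω_v ∘ (k ↦ k ⊗ 1)`; descend to the coinvariants at the line `(ε)`
  have h3 := TwistedCoinv.exists_equivariant_of_equivariant ((MpPsi.toRep (localSchrodinger (↥(maximalRealSubfield L)) 3 (realDiagonal L dV hdV) v)).comp (lineTransportSection (↥(maximalRealSubfield L)) L (IsCMField.complexConj L) 3 (complexConj_imagUnit L) (imagUnit_ne_zero L) (imagUnit_mul_self L) (realDiagonal L dV hdV) (realDiagonal_isSymm L dV hdV) (Matrix.diagonal dV) (realDiagonal_map L dV hdV).symm ε v ((chiLocalSplittingsCM L (Equiv.prodUnique (Fin 3) (Fin 1)) dV hdV hdV0 (toHeckeCharacter L μ) ((isOscillatorChar_toHeckeCharacter_iff μ).mpr hμ) ε).s v) ((chiLocalSplittingsCM L (Equiv.prodUnique (Fin 3) (Fin 1)) dV hdV hdV0 (toHeckeCharacter L μ) ((isOscillatorChar_toHeckeCharacter_iff μ).mpr hμ) ε).proj_s v)))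
    (show Representation ℂ (localPi L (IsCMField.complexConj L) 3 (Matrix.diagonal dV) v) (SchwartzBruhat (Fin 3 → v.adicCompletion (↥(maximalRealSubfield L)))) from
      ((chiLocalSplittingsCM L (Equiv.prodUnique (Fin 3) (Fin 1)) dV hdV hdV0 (toHeckeCharacter L μ) ((isOscillatorChar_toHeckeCharacter_iff μ).mpr hμ) ε).omegaLoc v).comp (localLineInl L (IsCMField.complexConj L) 3 (Equiv.prodUnique (Fin 3) (Fin 1)) (Matrix.diagonal dV) (JW (↥(maximalRealSubfield L)) L ε) v))
    (localCenter L (IsCMField.complexConj L) 3 (Matrix.diagonal dV) (JW (↥(maximalRealSubfield L)) L ε) (JW_apply_ne_zero (↥(maximalRealSubfield L)) L ε) v)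
    (localCharOfCenter (↥(maximalRealSubfield L)) L (IsCMField.complexConj L) (JW (↥(maximalRealSubfield L)) L ε) (JW_apply_ne_zero (↥(maximalRealSubfield L)) L ε) χf v)
    (fun g z => (show Commute g ((localCenter L (IsCMField.complexConj L) 3 (Matrix.diagonal dV) (JW (↥(maximalRealSubfield L)) L ε) (JW_apply_ne_zero (↥(maximalRealSubfield L)) L ε) v) z) from
      localCenter_comm L (IsCMField.complexConj L) 3 (Matrix.diagonal dV) (JW (↥(maximalRealSubfield L)) L ε) (JW_apply_ne_zero (↥(maximalRealSubfield L)) L ε) v z g).map ((MpPsi.toRep (localSchrodinger (↥(maximalRealSubfield L)) 3 (realDiagonal L dV hdV) v)).comp (lineTransportSection (↥(maximalRealSubfield L)) L (IsCMField.complexConj L) 3 (complexConj_imagUnit L) (imagUnit_ne_zero L) (imagUnit_mul_self L) (realDiagonal L dV hdV) (realDiagonal_isSymm L dV hdV) (Matrix.diagonal dV) (realDiagonal_map L dV hdV).symm ε v ((chiLocalSplittingsCM L (Equiv.prodUnique (Fin 3) (Fin 1)) dV hdV hdV0 (toHeckeCharacter L μ) ((isOscillatorChar_toHeckeCharacter_iff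 μ).mpr hμ) ε).s v) ((chiLocalSplittingsCM L (Equiv.prodUnique (Fin 3) (Fin 1)) dV hdV hdV0 (toHeckeCharacter L μ) ((isOscillatorChar_toHeckeCharacter_iff μ).mpr hμ) ε).proj_s v))))
    (fun g z => (show Commute g ((localCenter L (IsCMField.complexConj L) 3 (Matrix.diagonal dV) (JW (↥(maximalRealSubfield L)) L ε) (JW_apply_ne_zero (↥(maximalRealSubfield L)) L ε) v) z) from
      localCenter_comm L (IsCMField.complexConj L) 3 (Matrix.diagonal dV) (JW (↥(maximalRealSubfield L)) L ε) (JW_apply_ne_zero (↥(maximalRealSubfield L)) L ε) v z g).map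
        (show Representation ℂ (localPi L (IsCMField.complexConj L) 3 (Matrix.diagonal dV) v) (SchwartzBruhat (Fin 3 → v.adicCompletion (↥(maximalRealSubfield L)))) from
          ((chiLocalSplittingsCM L (Equiv.prodUnique (Fin 3) (Fin 1)) dV hdV hdV0 (toHeckeCharacter L μ) ((isOscillatorChar_toHeckeCharacter_iff μ).mpr hμ) ε).omegaLoc v).comp (localLineInl L (IsCMField.complexConj L) 3 (Equiv.prodUnique (Fin 3) (Fin 1)) (Matrix.diagonal dV) (JW (↥(maximalRealSubfield L)) L ε) v)))
    (LinearEquiv.refl ℂ _)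
    (fun g Φ => LinearMap.congr_fun (DFunLike.congr_fun
      (omega_lineTransportSection_finLocalSplittings (↥(maximalRealSubfield L)) L (IsCMField.complexConj L) 3 (complexConj_imagUnit L) (imagUnit_ne_zero L) (imagUnit_mul_self L) (realDiagonal L dV hdV) (realDiagonal_isSymm L dV hdV) (Matrix.diagonal dV) (realDiagonal_map L dV hdV).symm ε v (chiLocalSplittingsCM L (Equiv.prodUnique (Fin 3) (Fin 1)) dV hdV hdV0 (toHeckeCharacter L μ) ((isOscillatorChar_toHeckeCharacter_iff μ).mpr hμ) ε)) g) Φ)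
  -- (4) change of the line presenting the centre: `J₁` ↦ `(ε)`
  have h4 : AreIsomorphicRep
      (TwistedCoinv.rep
        (ρW := show Representation ℂ (localPi L (IsCMField.complexConj L) 1 J₁ v) (SchwartzBruhat (Fin 3 → v.adicCompletion (↥(maximalRealSubfield L)))) from
          ((MpPsi.toRep (localSchrodinger (↥(maximalRealSubfield L)) 3 (realDiagonal L dV hdV) v)).comp (lineTransportSection (↥(maximalRealSubfield L)) L (IsCMField.complexConj L) 3 (complexConj_imagUnit L) (imagUnit_ne_zero L) (imagUnit_mul_self L) (realDiagonal L dV hdV) (realDiagonal_isSymm L dV hdV) (Matrix.diagonal dV) (realDiagonal_map L dV hdV).symm ε v ((chiLocalSplittingsCM L (Equiv.prodUnique (Fin 3) (Fin 1)) dV hdV hdV0 (toHeckeCharacter L μ) ((isOscillatorChar_toHeckeCharacter_iff μ).mpr hμ) ε).s v) ((chiLocalSplittingsCM L (Equiv.prodUnique (Fin 3) (Fin 1)) dV hdV hdV0 (toHeckeCharacter L μ) ((isOscillatorChar_toHeckeCharacter_iff μ).mpr hμ) ε).proj_s v))).comp (localCenter L (IsCMField.complexConj L) 3 (Matrix.diagonal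 dV) J₁ hJ₁ v))
        (localCharOfCenter (↥(maximalRealSubfield L)) L (IsCMField.complexConj L) J₁ hJ₁ χf v) ((MpPsi.toRep (localSchrodinger (↥(maximalRealSubfield L)) 3 (realDiagonal L dV hdV) v)).comp (lineTransportSection (↥(maximalRealSubfield L)) L (IsCMField.complexConj L) 3 (complexConj_imagUnit L) (imagUnit_ne_zero L) (imagUnit_mul_self L) (realDiagonal L dV hdV) (realDiagonal_isSymm L dV hdV) (Matrix.diagonal dV) (realDiagonal_map L dV hdV).symm ε v ((chiLocalSplittingsCM L (Equiv.prodUnique (Fin 3) (Fin 1)) dV hdV hdV0 (toHeckeCharacter L μ) ((isOscillatorChar_toHeckeCharacter_iff μ).mpr hμ) ε).s v) ((chiLocalSplittingsCM L (Equiv.prodUnique (Fin 3) (Fin 1)) dV hdV hdV0 (toHeckeCharacter L μ) ((isOscillatorChar_toHeckeCharacter_iff μ).mpr hμ) ε).proj_s v)))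
        (fun g z => (show Commute g ((localCenter L (IsCMField.complexConj L) 3 (Matrix.diagonal dV) J₁ hJ₁ v) z) from
          localCenter_comm L (IsCMField.complexConj L) 3 (Matrix.diagonal dV) J₁ hJ₁ v z g).map ((MpPsi.toRep (localSchrodinger (↥(maximalRealSubfield L)) 3 (realDiagonal L dV hdV) v)).comp (lineTransportSection (↥(maximalRealSubfield L)) L (IsCMField.complexConj L) 3 (complexConj_imagUnit L) (imagUnit_ne_zero L) (imagUnit_mul_self L) (realDiagonal L dV hdV) (realDiagonal_isSymm L dV hdV) (Matrix.diagonal dV) (realDiagonal_map L dV hdV).symm ε v ((chiLocalSplittingsCM L (Equiv.prodUnique (Fin 3) (Fin 1)) dV hdV hdV0 (toHeckeCharacter L μ) ((isOscillatorChar_toHeckeCharacter_iff μ).mpr hμ) ε).s v) ((chiLocalSplittingsCM L (Equiv.prodUnique (Fin 3) (Fin 1)) dV hdV hdV0 (toHeckeCharacter L μ) ((isOscillatorChar_toHeckeCharacter_iff μ).mpr hμ) ε).proj_s v)))))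
      (TwistedCoinv.rep
        (ρW := show Representation ℂ (localPi L (IsCMField.complexConj L) 1 (JW (↥(maximalRealSubfield L)) L ε) v) (SchwartzBruhat (Fin 3 → v.adicCompletion (↥(maximalRealSubfield L)))) from
          ((MpPsi.toRep (localSchrodinger (↥(maximalRealSubfield L)) 3 (realDiagonal L dV hdV) v)).comp (lineTransportSection (↥(maximalRealSubfield L)) L (IsCMField.complexConj L) 3 (complexConj_imagUnit L) (imagUnit_ne_zero L) (imagUnit_mul_self L) (realDiagonal L dV hdV) (realDiagonal_isSymm L dV hdV) (Matrix.diagonal dV) (realDiagonal_map L dV hdV).symm ε v ((chiLocalSplittingsCM L (Equiv.prodUnique (Fin 3) (Fin 1)) dV hdV hdV0 (toHeckeCharacter L μ) ((isOscillatorChar_toHeckeCharacter_iff μ).mpr hμ) ε).s v) ((chiLocalSplittingsCM L (Equiv.prodUnique (Fin 3) (Fin 1)) dV hdV hdV0 (toHeckeCharacter L μ) ((isOscillatorChar_toHeckeCharacter_iff μ).mpr hμ) ε).proj_s v))).comp (localCenter L (IsCMField.complexConj L) 3 (Matrix.diagonal dV) (JW (↥(maximalRealSubfield L)) L ε) (JW_apply_ne_zero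 (↥(maximalRealSubfield L)) L ε) v))
        (localCharOfCenter (↥(maximalRealSubfield L)) L (IsCMField.complexConj L) (JW (↥(maximalRealSubfield L)) L ε) (JW_apply_ne_zero (↥(maximalRealSubfield L)) L ε) χf v) ((MpPsi.toRep (localSchrodinger (↥(maximalRealSubfield L)) 3 (realDiagonal L dV hdV) v)).comp (lineTransportSection (↥(maximalRealSubfield L)) L (IsCMField.complexConj L) 3 (complexConj_imagUnit L) (imagUnit_ne_zero L) (imagUnit_mul_self L) (realDiagonal L dV hdV) (realDiagonal_isSymm L dV hdV) (Matrix.diagonal dV) (realDiagonal_map L dV hdV).symm ε v ((chiLocalSplittingsCM L (Equiv.prodUnique (Fin 3) (Fin 1)) dV hdV hdV0 (toHeckeCharacter L μ) ((isOscillatorChar_toHeckeCharacter_iff μ).mpr hμ) ε).s v) ((chiLocalSplittingsCM L (Equiv.prodUnique (Fin 3) (Fin 1)) dV hdV hdV0 (toHeckeCharacter L μ) ((isOscillatorChar_toHeckeCharacter_iff μ).mpr hμ) ε).proj_s v)))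
        (fun g z => (show Commute g ((localCenter L (IsCMField.complexConj L) 3 (Matrix.diagonal dV) (JW (↥(maximalRealSubfield L)) L ε) (JW_apply_ne_zero (↥(maximalRealSubfield L)) L ε) v) z) from
          localCenter_comm L (IsCMField.complexConj L) 3 (Matrix.diagonal dV) (JW (↥(maximalRealSubfield L)) L ε) (JW_apply_ne_zero (↥(maximalRealSubfield L)) L ε) v z g).map ((MpPsi.toRep (localSchrodinger (↥(maximalRealSubfield L)) 3 (realDiagonal L dV hdV) v)).comp (lineTransportSection (↥(maximalRealSubfield L)) L (IsCMField.complexConj L) 3 (complexConj_imagUnit L) (imagUnit_ne_zero L) (imagUnit_mul_self L) (realDiagonal L dV hdV) (realDiagonal_isSymm L dV hdV) (Matrix.diagonal dV) (realDiagonal_map L dV hdV).symm ε v ((chiLocalSplittingsCM L (Equiv.prodUnique (Fin 3) (Fin 1)) dV hdV hdV0 (toHeckeCharacter L μ) ((isOscillatorChar_toHeckeCharacter_iff μ).mpr hμ) ε).s v) ((chiLocalSplittingsCM L (Equiv.prodUnique (Fin 3) (Fin 1)) dV hdV hdV0 (toHeckeCharacter L μ) ((isOscillatorChar_toHeckeCharacter_iff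 μ).mpr hμ) ε).proj_s v))))) :=
    areIsomorphicRep_coinv_of_ker_eq
      (LemD1OfPlace.ker_localCenter_eq_of_line L v (IsCMField.complexConj L) 3 (Matrix.diagonal dV) (complexConj_imagUnit L) (imagUnit_ne_zero L) (by norm_num) hJh hJdet ((MpPsi.toRep (localSchrodinger (↥(maximalRealSubfield L)) 3 (realDiagonal L dV hdV) v)).comp (lineTransportSection (↥(maximalRealSubfield L)) L (IsCMField.complexConj L) 3 (complexConj_imagUnit L) (imagUnit_ne_zero L) (imagUnit_mul_self L) (realDiagonal L dV hdV) (realDiagonal_isSymm L dV hdV) (Matrix.diagonal dV) (realDiagonal_map L dV hdV).symm ε v ((chiLocalSplittingsCM L (Equiv.prodUnique (Fin 3) (Fin 1)) dV hdV hdV0 (toHeckeCharacter L μ) ((isOscillatorChar_toHeckeCharacter_iff μ).mpr hμ) ε).s v) ((chiLocalSplittingsCM L (Equiv.prodUnique (Fin 3) (Fin 1)) dV hdV hdV0 (toHeckeCharacter L μ) ((isOscillatorChar_toHeckeCharacter_iff μ).mpr hμ) ε).proj_s v))) χf J₁ (JW (↥(maximalRealSubfield L)) L ε) hJ₁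
        (JW_apply_ne_zero (↥(maximalRealSubfield L)) L ε)) _ _
      (fun g => ((MpPsi.toRep (localSchrodinger (↥(maximalRealSubfield L)) 3 (realDiagonal L dV hdV) v)).comp (lineTransportSection (↥(maximalRealSubfield L)) L (IsCMField.complexConj L) 3 (complexConj_imagUnit L) (imagUnit_ne_zero L) (imagUnit_mul_self L) (realDiagonal L dV hdV) (realDiagonal_isSymm L dV hdV) (Matrix.diagonal dV) (realDiagonal_map L dV hdV).symm ε v ((chiLocalSplittingsCM L (Equiv.prodUnique (Fin 3) (Fin 1)) dV hdV hdV0 (toHeckeCharacter L μ) ((isOscillatorChar_toHeckeCharacter_iff μ).mpr hμ) ε).s v) ((chiLocalSplittingsCM L (Equiv.prodUnique (Fin 3) (Fin 1)) dV hdV hdV0 (toHeckeCharacter L μ) ((isOscillatorChar_toHeckeCharacter_iff μ).mpr hμ) ε).proj_s v))) g) (fun _ _ => rfl) (fun _ _ => rfl)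
  exact (h2.trans (AreIsomorphicRep.symm h3)).trans h4.symm

/-! ## §2 HEAD: an isomorphism of two theta types at a non-split place forces the lines into one norm class -/

include hcont hunit in
set_option synthInstance.maxHeartbeats 400000 in
set_option maxHeartbeats 16000000 in
/-- **RANK-3 ε-RIGIDITY (road (T) step (5)).**  `L` CM, `dV` a real non-zero diagonal frame of rank 3, `μ` conjugate-symplectic, `χ_f` a CONTINUOUS
UNITARY character of `U(1)(𝔸_{L⁺,f})`, `v` NON-SPLIT, `ε₁, ε₂ ∈ (L⁺)ˣ`: if Liu's local theta types `X_v(μ, ε₁, χ_f)` and `X_v(μ, ε₂, χ_f)`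
(★ `xThetaCM`, representations of the SAME group `U(diag dV)(L⁺_v)`) are «isomorphic» (★ `AreIsomorphicRep`), then `ε₂ε₁⁻¹` is a local norm:
`∃ x ∈ L_wˣ, x · x̄ = ε₂ε₁⁻¹` in `L_w = L ⊗ L⁺_v`.  Proof: §1 at the common line `J₁ := (ε₁)` for both, `Θ_{s_{ε₁}}(χ_{f,v}) ≠ 0` by the PROVED
[MVW87 IV.2] (★ `mvw_IV2_rankOne_nonvanishing_of_isotropic_holds`; rank 3 is isotropic, ★ `isIsotropic_standingData_of_three_le`), the PROVED
separation of rank-one theta lifts of lines in different classes (★ `rankOne_theta_epsClass_and_char_eq_of_areIsomorphicRep_unconditional` over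
★ IV-4c1 `rankOne_theta_lines_disjoint_holds`), and the class read-out `eps (ε₂⁻¹δ) ~ eps (ε₁⁻¹δ) ⟺ (ε₂δ) ⊗ 1 ~ (ε₁δ) ⊗ 1`
(★ `sameClass_epsLine_iff_sameClass_eps_lineDelta`, ★ `coe_epsLine`). [cite: MoeglinVignerasWaldspurger1987, Chap. 3 IV.4 Thm principal; IV.2]
[cite: Liu2021, App. D Lem. D.1 (3) (l. 5233)] [cite: HarrisKudlaSweet1996, Cor. 4.4 (m = n = 1) p. 962] -/
theorem exists_mul_conj_eq_ratio_of_areIsomorphicRep_xThetaCM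
    (hv : ∀ w : PlacesOver L v, IsCMField.complexConj L • w.1 = w.1) (ε₁ ε₂ : (↥(maximalRealSubfield L))ˣ)
    (hiso : AreIsomorphicRep (xThetaCM L (Equiv.prodUnique (Fin 3) (Fin 1)) dV hdV hdV0 μ hμ χf ε₁ v) (xThetaCM L (Equiv.prodUnique (Fin 3) (Fin 1)) dV hdV hdV0 μ hμ χf ε₂ v)) :
    ∃ x : (UnitaryGroup.LocalRing L v)ˣ,
      (x : UnitaryGroup.LocalRing L v) * conjLocal L (IsCMField.complexConj L) v x =
        algebraMap L (UnitaryGroup.LocalRing L v) (((ε₂ * ε₁⁻¹ : (↥(maximalRealSubfield L))ˣ) : ↥(maximalRealSubfield L)) : L) := by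
  -- the place: `L ⊗ L⁺_v` is a field; the frame: hermitian, invertible
  obtain ⟨w⟩ := (inferInstance : Nonempty (PlacesOver L v))
  have hE : IsField (UnitaryGroup.LocalRing L v) :=
    LemD1IndexedNonVacuityNonsplitPlace.isField_localRing_of_nonsplit L v (IsCMField.complexConj L) (complexConj_imagUnit L) (imagUnit_ne_zero L) w (hv w)
  have hJh : ((Matrix.diagonal dV).map (IsCMField.complexConj L))ᵀ = Matrix.diagonal dV :=
    transpose_map_conj_JV (↥(maximalRealSubfield L)) L (IsCMField.complexConj L) 3 (Matrix.diagonal dV) (realDiagonal_isSymm L dV hdV) (realDiagonal_map L dV hdV).symm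
  have hJdet : (Matrix.diagonal dV).det ≠ 0 := det_JV_ne_zero (↥(maximalRealSubfield L)) L 3 (Matrix.diagonal dV) (isUnit_det_realDiagonal L dV hdV hdV0) (realDiagonal_map L dV hdV).symm
  have hχu := norm_localCharOfCenter (↥(maximalRealSubfield L)) L (IsCMField.complexConj L) (JW (↥(maximalRealSubfield L)) L ε₁) (JW_apply_ne_zero (↥(maximalRealSubfield L)) L ε₁) hunit v
  have hχc := continuous_coe_localCharOfCenter (↥(maximalRealSubfield L)) L (IsCMField.complexConj L) (JW (↥(maximalRealSubfield L)) L ε₁) (JW_apply_ne_zero (↥(maximalRealSubfield L)) L ε₁) hcont v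
  -- §1 for both lines, at the common presentation `J₁ := (ε₁)` of the centre
  have h₁ := areIsomorphicRep_xThetaCM_theta L dV hdV hdV0 μ hμ χf v ε₁ (JW (↥(maximalRealSubfield L)) L ε₁) (JW_apply_ne_zero (↥(maximalRealSubfield L)) L ε₁)
  have h₂ := areIsomorphicRep_xThetaCM_theta L dV hdV hdV0 μ hμ χf v ε₂ (JW (↥(maximalRealSubfield L)) L ε₁) (JW_apply_ne_zero (↥(maximalRealSubfield L)) L ε₁)
  have hisoY := (h₁.symm.trans hiso).trans h₂
  -- non-vanishing of `Θ_{s_{ε₁}}(χ_{f,v})`: [MVW87 IV.2] PROVED, rank 3 isotropic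
  have hnt := mvw_IV2_rankOne_nonvanishing_of_isotropic_holds (↥(maximalRealSubfield L)) L (IsCMField.complexConj L) 3 _ (conj_lineDelta (complexConj_imagUnit L) ε₁) (lineDelta_ne_zero (imagUnit_ne_zero L) ε₁) _
    (lineDelta_mul_self (imagUnit_mul_self L) ε₁) (realDiagonal L dV hdV) (realDiagonal_isSymm L dV hdV) (isUnit_det_realDiagonal L dV hdV hdV0) (Matrix.diagonal dV) (realDiagonal_map L dV hdV).symm v hE (by norm_num) hJh hJdet
    (LemD1OfPlace.isIsotropic_standingData_of_three_le L v (IsCMField.complexConj L) 3 (Matrix.diagonal dV) (conj_lineDelta (complexConj_imagUnit L) ε₁) (lineDelta_ne_zero (imagUnit_ne_zero L) ε₁)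
      (by norm_num) hJh hJdet le_rfl)
    (lineTransportSection (↥(maximalRealSubfield L)) L (IsCMField.complexConj L) 3 (complexConj_imagUnit L) (imagUnit_ne_zero L) (imagUnit_mul_self L) (realDiagonal L dV hdV) (realDiagonal_isSymm L dV hdV) (Matrix.diagonal dV) (realDiagonal_map L dV hdV).symm ε₁ v ((chiLocalSplittingsCM L (Equiv.prodUnique (Fin 3) (Fin 1)) dV hdV hdV0 (toHeckeCharacter L μ) ((isOscillatorChar_toHeckeCharacter_iff μ).mpr hμ) ε₁).s v) ((chiLocalSplittingsCM L (Equiv.prodUnique (Fin 3) (Fin 1)) dV hdV hdV0 (toHeckeCharacter L μ) ((isOscillatorChar_toHeckeCharacter_iff μ).mpr hμ) ε₁).proj_s v)) (proj_lineTransportSection (↥(maximalRealSubfield L)) L (IsCMField.complexConj L) 3 (complexConj_imagUnit L) (imagUnit_ne_zero L) (imagUnit_mul_self L) (realDiagonal L dV hdV) (realDiagonal_isSymm L dV hdV) (Matrix.diagonal dV) (realDiagonal_map L dV hdV).symm ε₁ v ((chiLocalSplittingsCM L (Equiv.prodUnique (Fin 3) (Fin 1)) dV hdV hdV0 (toHeckeCharacter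 L μ) ((isOscillatorChar_toHeckeCharacter_iff μ).mpr hμ) ε₁).s v) ((chiLocalSplittingsCM L (Equiv.prodUnique (Fin 3) (Fin 1)) dV hdV hdV0 (toHeckeCharacter L μ) ((isOscillatorChar_toHeckeCharacter_iff μ).mpr hμ) ε₁).proj_s v))
    (isSmooth_lineTransportSection (↥(maximalRealSubfield L)) L (IsCMField.complexConj L) 3 (complexConj_imagUnit L) (imagUnit_ne_zero L) (imagUnit_mul_self L) (realDiagonal L dV hdV) (realDiagonal_isSymm L dV hdV) (Matrix.diagonal dV) (realDiagonal_map L dV hdV).symm ε₁ v ((chiLocalSplittingsCM L (Equiv.prodUnique (Fin 3) (Fin 1)) dV hdV hdV0 (toHeckeCharacter L μ) ((isOscillatorChar_toHeckeCharacter_iff μ).mpr hμ) ε₁).s v) ((chiLocalSplittingsCM L (Equiv.prodUnique (Fin 3) (Fin 1)) dV hdV hdV0 (toHeckeCharacter L μ) ((isOscillatorChar_toHeckeCharacter_iff μ).mpr hμ) ε₁).proj_s v) ((chiLocalSplittingsCM L (Equiv.prodUnique (Fin 3) (Fin 1)) dV hdV hdV0 (toHeckeCharacter L μ) ((isOscillatorChar_toHeckeCharacter_iff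 μ).mpr hμ) ε₁).smooth v))
    (JW (↥(maximalRealSubfield L)) L ε₁) (JW_apply_ne_zero (↥(maximalRealSubfield L)) L ε₁) (localCharOfCenter (↥(maximalRealSubfield L)) L (IsCMField.complexConj L) (JW (↥(maximalRealSubfield L)) L ε₁) (JW_apply_ne_zero (↥(maximalRealSubfield L)) L ε₁) χf v) hχu hχc
  -- the separation of rank-one theta lifts (PROVED IV-4c1)
  obtain ⟨hcls, -⟩ := rankOne_theta_epsClass_and_char_eq_of_areIsomorphicRep_unconditional (↥(maximalRealSubfield L)) L (IsCMField.complexConj L)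
    _ (conj_lineDelta (complexConj_imagUnit L) ε₁) (lineDelta_ne_zero (imagUnit_ne_zero L) ε₁) _ (lineDelta_mul_self (imagUnit_mul_self L) ε₁)
    _ (conj_lineDelta (complexConj_imagUnit L) ε₂) (lineDelta_ne_zero (imagUnit_ne_zero L) ε₂) _ (lineDelta_mul_self (imagUnit_mul_self L) ε₂)
    (realDiagonal L dV hdV) (realDiagonal_isSymm L dV hdV) (isUnit_det_realDiagonal L dV hdV hdV0) (Matrix.diagonal dV) (realDiagonal_map L dV hdV).symm v hE
    (lineTransportSection (↥(maximalRealSubfield L)) L (IsCMField.complexConj L) 3 (complexConj_imagUnit L) (imagUnit_ne_zero L) (imagUnit_mul_self L) (realDiagonal L dV hdV) (realDiagonal_isSymm L dV hdV) (Matrix.diagonal dV) (realDiagonal_map L dV hdV).symm ε₁ v ((chiLocalSplittingsCM L (Equiv.prodUnique (Fin 3) (Fin 1)) dV hdV hdV0 (toHeckeCharacter L μ) ((isOscillatorChar_toHeckeCharacter_iff μ).mpr hμ) ε₁).s v) ((chiLocalSplittingsCM L (Equiv.prodUnique (Fin 3) (Fin 1)) dV hdV hdV0 (toHeckeCharacter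 L μ) ((isOscillatorChar_toHeckeCharacter_iff μ).mpr hμ) ε₁).proj_s v)) (lineTransportSection (↥(maximalRealSubfield L)) L (IsCMField.complexConj L) 3 (complexConj_imagUnit L) (imagUnit_ne_zero L) (imagUnit_mul_self L) (realDiagonal L dV hdV) (realDiagonal_isSymm L dV hdV) (Matrix.diagonal dV) (realDiagonal_map L dV hdV).symm ε₂ v ((chiLocalSplittingsCM L (Equiv.prodUnique (Fin 3) (Fin 1)) dV hdV hdV0 (toHeckeCharacter L μ) ((isOscillatorChar_toHeckeCharacter_iff μ).mpr hμ) ε₂).s v) ((chiLocalSplittingsCM L (Equiv.prodUnique (Fin 3) (Fin 1)) dV hdV hdV0 (toHeckeCharacter L μ) ((isOscillatorChar_toHeckeCharacter_iff μ).mpr hμ) ε₂).proj_s v))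
    (proj_lineTransportSection (↥(maximalRealSubfield L)) L (IsCMField.complexConj L) 3 (complexConj_imagUnit L) (imagUnit_ne_zero L) (imagUnit_mul_self L) (realDiagonal L dV hdV) (realDiagonal_isSymm L dV hdV) (Matrix.diagonal dV) (realDiagonal_map L dV hdV).symm ε₁ v ((chiLocalSplittingsCM L (Equiv.prodUnique (Fin 3) (Fin 1)) dV hdV hdV0 (toHeckeCharacter L μ) ((isOscillatorChar_toHeckeCharacter_iff μ).mpr hμ) ε₁).s v) ((chiLocalSplittingsCM L (Equiv.prodUnique (Fin 3) (Fin 1)) dV hdV hdV0 (toHeckeCharacter L μ) ((isOscillatorChar_toHeckeCharacter_iff μ).mpr hμ) ε₁).proj_s v))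
    (proj_lineTransportSection (↥(maximalRealSubfield L)) L (IsCMField.complexConj L) 3 (complexConj_imagUnit L) (imagUnit_ne_zero L) (imagUnit_mul_self L) (realDiagonal L dV hdV) (realDiagonal_isSymm L dV hdV) (Matrix.diagonal dV) (realDiagonal_map L dV hdV).symm ε₂ v ((chiLocalSplittingsCM L (Equiv.prodUnique (Fin 3) (Fin 1)) dV hdV hdV0 (toHeckeCharacter L μ) ((isOscillatorChar_toHeckeCharacter_iff μ).mpr hμ) ε₂).s v) ((chiLocalSplittingsCM L (Equiv.prodUnique (Fin 3) (Fin 1)) dV hdV hdV0 (toHeckeCharacter L μ) ((isOscillatorChar_toHeckeCharacter_iff μ).mpr hμ) ε₂).proj_s v))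
    (isSmooth_lineTransportSection (↥(maximalRealSubfield L)) L (IsCMField.complexConj L) 3 (complexConj_imagUnit L) (imagUnit_ne_zero L) (imagUnit_mul_self L) (realDiagonal L dV hdV) (realDiagonal_isSymm L dV hdV) (Matrix.diagonal dV) (realDiagonal_map L dV hdV).symm ε₁ v ((chiLocalSplittingsCM L (Equiv.prodUnique (Fin 3) (Fin 1)) dV hdV hdV0 (toHeckeCharacter L μ) ((isOscillatorChar_toHeckeCharacter_iff μ).mpr hμ) ε₁).s v) ((chiLocalSplittingsCM L (Equiv.prodUnique (Fin 3) (Fin 1)) dV hdV hdV0 (toHeckeCharacter L μ) ((isOscillatorChar_toHeckeCharacter_iff μ).mpr hμ) ε₁).proj_s v) ((chiLocalSplittingsCM L (Equiv.prodUnique (Fin 3) (Fin 1)) dV hdV hdV0 (toHeckeCharacter L μ) ((isOscillatorChar_toHeckeCharacter_iff μ).mpr hμ) ε₁).smooth v))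
    (isSmooth_lineTransportSection (↥(maximalRealSubfield L)) L (IsCMField.complexConj L) 3 (complexConj_imagUnit L) (imagUnit_ne_zero L) (imagUnit_mul_self L) (realDiagonal L dV hdV) (realDiagonal_isSymm L dV hdV) (Matrix.diagonal dV) (realDiagonal_map L dV hdV).symm ε₂ v ((chiLocalSplittingsCM L (Equiv.prodUnique (Fin 3) (Fin 1)) dV hdV hdV0 (toHeckeCharacter L μ) ((isOscillatorChar_toHeckeCharacter_iff μ).mpr hμ) ε₂).s v) ((chiLocalSplittingsCM L (Equiv.prodUnique (Fin 3) (Fin 1)) dV hdV hdV0 (toHeckeCharacter L μ) ((isOscillatorChar_toHeckeCharacter_iff μ).mpr hμ) ε₂).proj_s v) ((chiLocalSplittingsCM L (Equiv.prodUnique (Fin 3) (Fin 1)) dV hdV hdV0 (toHeckeCharacter L μ) ((isOscillatorChar_toHeckeCharacter_iff μ).mpr hμ) ε₂).smooth v))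
    (JW (↥(maximalRealSubfield L)) L ε₁) (JW_apply_ne_zero (↥(maximalRealSubfield L)) L ε₁) (localCharOfCenter (↥(maximalRealSubfield L)) L (IsCMField.complexConj L) (JW (↥(maximalRealSubfield L)) L ε₁) (JW_apply_ne_zero (↥(maximalRealSubfield L)) L ε₁) χf v) (localCharOfCenter (↥(maximalRealSubfield L)) L (IsCMField.complexConj L) (JW (↥(maximalRealSubfield L)) L ε₁) (JW_apply_ne_zero (↥(maximalRealSubfield L)) L ε₁) χf v) hχu hχc hχu hχc hnt hisoY
  -- class read-out: `eps (ε₂⁻¹δ) ~ eps (ε₁⁻¹δ)` ⟺ `(ε₂δ) ⊗ 1 ~ (ε₁δ) ⊗ 1` ⟹ `ε₂ε₁⁻¹ = y·ȳ`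
  obtain ⟨y, hy⟩ := (sameClass_epsLine_iff_sameClass_eps_lineDelta (↥(maximalRealSubfield L)) L (IsCMField.complexConj L) v (hδ := (imagUnit_ne_zero L)) ε₁ ε₂).2 hcls
  refine ⟨y, ?_⟩
  have hq := congrArg Units.val hy.symm
  rw [Units.val_mul, Units.val_mul, Units.coe_map, MonoidHom.coe_coe, coe_epsLine, coe_epsLine] at hq
  -- in the field `L`: `(ε₂δ) = (ε₂ε₁⁻¹)·(ε₁δ)`; cancel the unit `(ε₁δ) ⊗ 1`
  have hL : algebraMap (↥(maximalRealSubfield L)) L ((ε₂ : (↥(maximalRealSubfield L))ˣ) : ↥(maximalRealSubfield L)) * imagUnit L =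
      (((ε₂ * ε₁⁻¹ : (↥(maximalRealSubfield L))ˣ) : ↥(maximalRealSubfield L)) : L) *
        (algebraMap (↥(maximalRealSubfield L)) L ((ε₁ : (↥(maximalRealSubfield L))ˣ) : ↥(maximalRealSubfield L)) * imagUnit L) := by
    have hc : ∀ x : ↥(maximalRealSubfield L), (x : L) = algebraMap (↥(maximalRealSubfield L)) L x := fun _ => rfl
    rw [hc, ← mul_assoc, ← map_mul, Units.val_mul, Units.inv_mul_cancel_right]
  rw [hL, map_mul (algebraMap L (UnitaryGroup.LocalRing L v))
    ((((ε₂ * ε₁⁻¹ : (↥(maximalRealSubfield L))ˣ) : ↥(maximalRealSubfield L)) : L))] at hq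
  have hu : IsUnit (algebraMap L (UnitaryGroup.LocalRing L v)
      (algebraMap (↥(maximalRealSubfield L)) L ((ε₁ : (↥(maximalRealSubfield L))ˣ) : ↥(maximalRealSubfield L)) * imagUnit L)) := by
    rw [← coe_epsLine L (imagUnit_ne_zero L) ε₁ v]
    exact Units.isUnit _
  exact hu.mul_right_cancel hq

/-! ## §3 Front-ends: from a `Representation.Equiv`, and from the transports to `Gqs L v = U(Φ₃)(L⁺_v)` through ONE common congruence -/

/-- «isomorphic» (★ `AreIsomorphicRep`) descends along two successive SURJECTIVE changes of group: if `(ρ₁ ∘ φ) ∘ ψ ≅ (ρ₂ ∘ φ) ∘ ψ` with `φ`, `ψ`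
onto then `ρ₁ ≅ ρ₂` (the same linear isomorphism; generic plumbing stated in the syntactic shape of the transports below). [folklore] -/
theorem areIsomorphicRep_of_comp_comp_surjective {G G' G'' V₁ V₂ : Type*} [Group G] [Group G'] [Group G''] [AddCommGroup V₁] [Module ℂ V₁]
    [AddCommGroup V₂] [Module ℂ V₂] (ρ₁ : Representation ℂ G V₁) (ρ₂ : Representation ℂ G V₂) (φ : G' →* G) (ψ : G'' →* G')
    (hφ : Function.Surjective φ) (hψ : Function.Surjective ψ)
    (hiso : AreIsomorphicRep (show Representation ℂ G'' V₁ from ((ρ₁ : G →* _).comp φ).comp ψ)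
      (show Representation ℂ G'' V₂ from ((ρ₂ : G →* _).comp φ).comp ψ)) :
    AreIsomorphicRep ρ₁ ρ₂ := by
  obtain ⟨f, hf⟩ := hiso
  refine ⟨f, fun g x => ?_⟩
  obtain ⟨g', rfl⟩ := hφ g
  obtain ⟨g'', rfl⟩ := hψ g'
  exact hf g'' x

include hcont hunit in
set_option synthInstance.maxHeartbeats 400000 in
set_option maxHeartbeats 16000000 in
/-- **ε-rigidity from an equivalence of representations** (Mathlib `Representation.Equiv` ⇒ ★ `AreIsomorphicRep`, ★ `areIsomorphicRep_of_equiv`).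
[cite: MoeglinVignerasWaldspurger1987, Chap. 3 IV.4 Thm principal] [cite: Liu2021, App. D Lem. D.1 (3) (l. 5233)] -/
theorem exists_mul_conj_eq_ratio_of_equiv_xThetaCM
    (hv : ∀ w : PlacesOver L v, IsCMField.complexConj L • w.1 = w.1) (ε₁ ε₂ : (↥(maximalRealSubfield L))ˣ)
    (e : Representation.Equiv (xThetaCM L (Equiv.prodUnique (Fin 3) (Fin 1)) dV hdV hdV0 μ hμ χf ε₁ v) (xThetaCM L (Equiv.prodUnique (Fin 3) (Fin 1)) dV hdV hdV0 μ hμ χf ε₂ v)) :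
    ∃ x : (UnitaryGroup.LocalRing L v)ˣ,
      (x : UnitaryGroup.LocalRing L v) * conjLocal L (IsCMField.complexConj L) v x =
        algebraMap L (UnitaryGroup.LocalRing L v) (((ε₂ * ε₁⁻¹ : (↥(maximalRealSubfield L))ˣ) : ↥(maximalRealSubfield L)) : L) :=
  exists_mul_conj_eq_ratio_of_areIsomorphicRep_xThetaCM L dV hdV hdV0 μ hμ χf hcont hunit v hv ε₁ ε₂ (areIsomorphicRep_of_equiv e)

include hcont hunit in
set_option synthInstance.maxHeartbeats 400000 in
set_option maxHeartbeats 16000000 in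
/-- **ε-rigidity ON `Gqs L v = U(Φ₃)(L⁺_v)` through ONE common congruence** (road (T) step (4) ends there): for a CM frame `ᵗ(c̄ g) H g = diag dV`
and a form congruence `ᵗT̄ H_v T = a Φ₃`, if the two transports `πG^{εᵢ} := X_v(μ, εᵢ, χ_f) ∘ κ_v⁻¹ ∘ ((cmDatumLocalCongr v T).trans (localPiEquiv v)⁻¹)`
(the registered K1 sub-line's spelling, SAME `κ_v`, `T` for both) are «isomorphic» as representations of `Gqs L v`, then `ε₂ε₁⁻¹` is a local norm
(the common changes of group are onto: `areIsomorphicRep_of_comp_comp_surjective`, then §2). [cite: MoeglinVignerasWaldspurger1987, Chap. 3 IV.4 Thm principal]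
[cite: PlatonovRapinchuk1994, §2.3] [cite: Liu2021, App. D Lem. D.1 (3) (l. 5233)] -/
theorem exists_mul_conj_eq_ratio_of_areIsomorphicRep_xThetaGqs (H : Matrix (Fin 3) (Fin 3) L) (g : GL (Fin 3) L)
    (hg : ((g : Matrix (Fin 3) (Fin 3) L).map (cmConjRingHom L))ᵀ * H * (g : Matrix (Fin 3) (Fin 3) L) = Matrix.diagonal dV)
    (hv : ∀ w : PlacesOver L v, IsCMField.complexConj L • w.1 = w.1)
    (T : GL (Fin 3) (UnitaryGroup.LocalRing L v)) (a : UnitaryGroup.LocalRing L v) (ha : IsUnit a)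
    (h : formCongr (conjLocal L (IsCMField.complexConj L) v) T (H.map (algebraMap L (UnitaryGroup.LocalRing L v))) =
      a • (Matrix.of fun i j : Fin 3 => if i.val + j.val + 1 = 3 then (1 : L) else 0).map (algebraMap L (UnitaryGroup.LocalRing L v)))
    (ε₁ ε₂ : (↥(maximalRealSubfield L))ˣ)
    (hiso : AreIsomorphicRep
      ((((xThetaCM L (Equiv.prodUnique (Fin 3) (Fin 1)) dV hdV hdV0 μ hμ χf ε₁ v) :
          localPi L (IsCMField.complexConj L) 3 (Matrix.diagonal dV) v →* _).comp
          (localCongr L (IsCMField.complexConj L) g one_ne_zero (by rw [one_smul]; exact hg) v).symm.toMulEquiv.toMonoidHom).comp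
        ((cmDatumLocalCongr L v T ha h).trans (localPiEquiv L (IsCMField.complexConj L) 3 H v).symm).toMulEquiv.toMonoidHom)
      ((((xThetaCM L (Equiv.prodUnique (Fin 3) (Fin 1)) dV hdV hdV0 μ hμ χf ε₂ v) :
          localPi L (IsCMField.complexConj L) 3 (Matrix.diagonal dV) v →* _).comp
          (localCongr L (IsCMField.complexConj L) g one_ne_zero (by rw [one_smul]; exact hg) v).symm.toMulEquiv.toMonoidHom).comp
        ((cmDatumLocalCongr L v T ha h).trans (localPiEquiv L (IsCMField.complexConj L) 3 H v).symm).toMulEquiv.toMonoidHom)) :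
    ∃ x : (UnitaryGroup.LocalRing L v)ˣ,
      (x : UnitaryGroup.LocalRing L v) * conjLocal L (IsCMField.complexConj L) v x =
        algebraMap L (UnitaryGroup.LocalRing L v) (((ε₂ * ε₁⁻¹ : (↥(maximalRealSubfield L))ˣ) : ↥(maximalRealSubfield L)) : L) :=
  exists_mul_conj_eq_ratio_of_areIsomorphicRep_xThetaCM L dV hdV hdV0 μ hμ χf hcont hunit v hv ε₁ ε₂
    (areIsomorphicRep_of_comp_comp_surjective (xThetaCM L (Equiv.prodUnique (Fin 3) (Fin 1)) dV hdV hdV0 μ hμ χf ε₁ v) (xThetaCM L (Equiv.prodUnique (Fin 3) (Fin 1)) dV hdV hdV0 μ hμ χf ε₂ v)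
      (localCongr L (IsCMField.complexConj L) g one_ne_zero (by rw [one_smul]; exact hg) v).symm.toMulEquiv.toMonoidHom ((cmDatumLocalCongr L v T ha h).trans (localPiEquiv L (IsCMField.complexConj L) 3 H v).symm).toMulEquiv.toMonoidHom
      (localCongr L (IsCMField.complexConj L) g one_ne_zero (by rw [one_smul]; exact hg) v).symm.surjective ((cmDatumLocalCongr L v T ha h).trans (localPiEquiv L (IsCMField.complexConj L) 3 H v).symm).surjective hiso)

include hcont hunit in
set_option synthInstance.maxHeartbeats 400000 in
set_option maxHeartbeats 16000000 in
/-- **ε-rigidity from EQUAL CLASSES in `Irr(U(Φ₃)(L⁺_v))`**: if road (T) step (4) ends in `⟦πG^{ε₁}⟧ = ⟦πG^{ε₂}⟧` (★ `IrrClass.mk` of the two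
irreducible smooth transports, ★ `F0P2oXThetaOwnClass.isIrreducible_xThetaGqs` ∕ `isSmooth_xThetaGqs`), then `ε₂ε₁⁻¹` is a local norm
(★ `IrrClass.mk_eq_mk_iff` ⇒ an equivalence ⇒ the previous theorem). [cite: MoeglinVignerasWaldspurger1987, Chap. 3 IV.4 Thm principal]
[cite: BushnellHenniart2006, §1.1] [cite: Liu2021, App. D Lem. D.1 (3) (l. 5233)] -/
theorem exists_mul_conj_eq_ratio_of_mk_xThetaGqs_eq (H : Matrix (Fin 3) (Fin 3) L) (g : GL (Fin 3) L)
    (hg : ((g : Matrix (Fin 3) (Fin 3) L).map (cmConjRingHom L))ᵀ * H * (g : Matrix (Fin 3) (Fin 3) L) = Matrix.diagonal dV)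
    (hv : ∀ w : PlacesOver L v, IsCMField.complexConj L • w.1 = w.1)
    (T : GL (Fin 3) (UnitaryGroup.LocalRing L v)) (a : UnitaryGroup.LocalRing L v) (ha : IsUnit a)
    (h : formCongr (conjLocal L (IsCMField.complexConj L) v) T (H.map (algebraMap L (UnitaryGroup.LocalRing L v))) =
      a • (Matrix.of fun i j : Fin 3 => if i.val + j.val + 1 = 3 then (1 : L) else 0).map (algebraMap L (UnitaryGroup.LocalRing L v)))
    (ε₁ ε₂ : (↥(maximalRealSubfield L))ˣ)
    (hmk : IrrClass.mk
        { V := _,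
          ρ := (((xThetaCM L (Equiv.prodUnique (Fin 3) (Fin 1)) dV hdV hdV0 μ hμ χf ε₁ v) :
              localPi L (IsCMField.complexConj L) 3 (Matrix.diagonal dV) v →* _).comp
              (localCongr L (IsCMField.complexConj L) g one_ne_zero (by rw [one_smul]; exact hg) v).symm.toMulEquiv.toMonoidHom).comp
            ((cmDatumLocalCongr L v T ha h).trans (localPiEquiv L (IsCMField.complexConj L) 3 H v).symm).toMulEquiv.toMonoidHom,
          isIrreducible := F0P2oXThetaOwnClass.isIrreducible_xThetaGqs L H (Equiv.prodUnique (Fin 3) (Fin 1)) dV hdV hdV0 g hg μ hμ χf hcont hunit ε₁ v T a ha h,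
          isSmooth := F0P2oXThetaOwnClass.isSmooth_xThetaGqs L H (Equiv.prodUnique (Fin 3) (Fin 1)) dV hdV hdV0 g hg μ hμ χf hcont hunit ε₁ v T a ha h } =
      IrrClass.mk
        { V := _,
          ρ := (((xThetaCM L (Equiv.prodUnique (Fin 3) (Fin 1)) dV hdV hdV0 μ hμ χf ε₂ v) :
              localPi L (IsCMField.complexConj L) 3 (Matrix.diagonal dV) v →* _).comp
              (localCongr L (IsCMField.complexConj L) g one_ne_zero (by rw [one_smul]; exact hg) v).symm.toMulEquiv.toMonoidHom).comp
            ((cmDatumLocalCongr L v T ha h).trans (localPiEquiv L (IsCMField.complexConj L) 3 H v).symm).toMulEquiv.toMonoidHom,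
          isIrreducible := F0P2oXThetaOwnClass.isIrreducible_xThetaGqs L H (Equiv.prodUnique (Fin 3) (Fin 1)) dV hdV hdV0 g hg μ hμ χf hcont hunit ε₂ v T a ha h,
          isSmooth := F0P2oXThetaOwnClass.isSmooth_xThetaGqs L H (Equiv.prodUnique (Fin 3) (Fin 1)) dV hdV hdV0 g hg μ hμ χf hcont hunit ε₂ v T a ha h }) :
    ∃ x : (UnitaryGroup.LocalRing L v)ˣ,
      (x : UnitaryGroup.LocalRing L v) * conjLocal L (IsCMField.complexConj L) v x =
        algebraMap L (UnitaryGroup.LocalRing L v) (((ε₂ * ε₁⁻¹ : (↥(maximalRealSubfield L))ˣ) : ↥(maximalRealSubfield L)) : L) := by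
  obtain ⟨e⟩ := (IrrClass.mk_eq_mk_iff _ _).1 hmk
  exact exists_mul_conj_eq_ratio_of_areIsomorphicRep_xThetaGqs L dV hdV hdV0 μ hμ χf hcont hunit v H g hg hv T a ha h ε₁ ε₂
    (areIsomorphicRep_of_equiv e)

end Summit.HodgeConjecture.HodgeConjecture.Cruxes.H413.F0P2oXThetaLineRigidity

end
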